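import Summits.QuantumFields.YangMills.Theorems.BalabanUVNodesN12AtRecord13OfResiduals
import Summits.QuantumFields.YangMills.Theorems.BalabanUVNodesN12AtRecord13LiveLineChi

/-!
# BalabanUVNodes ∕ N12 — χ-GENERIC RE-ISSUE (RC-1 «RE-CENTRE THE RECORD», director-ym №462 (B) ∕ №467 (D)) of `…N12AtRecord13OfResiduals` §1: N12's ROW AT THE χ-LIVE
# RE-PIN's BUNDLE `WOfRecord₁₃Chi (Θ.liveRepin₁₃Chi χ) χ λ P` FROM K0b's RESIDUALS OF RECORD ALONE (the rows N12 reads are theorems of `HasResidualsOfRecord`, χ-generic)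

Cell `pub-ymgap` (HUMAN RULING D-0062), seat `pub-ymgap-dag-n12-d` g36 (R134 N12 [B15] s2 «knit at the record»).  Sibling of `BalabanUVNodesN12AtRecord13OfResiduals` (this seat).

WHY.  The route's K-cruxes read the RE-CENTRED record since rev 31∕32 ([Ax-2]∕[Ax-3]: `Node00/SmallFieldChi29AxOfRecord`, `Node00/Record13{Ax,Chi,CoPHChi,SepCoPHChi}` — the
Stage-13 chain re-issued GENERIC in the β-slot `χ : ChiSlot F N`; node00-def-Y's `Node00/Record13LiveSelectorChi` — the live re-pin `liveRepin₁₃Chi θ χ` and `Record13` §4c's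
rows in the χ slot).  This seat's kernel σ-closure of N12's junction of record (`N12-SIGMA-CLOSURE-Ax.g36.md`, evidence #2 on 27239; dag-lead g40 WORDS 584 ∕ HANDS-3 addendum:
«N12 road at the re-centred record = dag-n12-d's lane») lists the 13 N12-side statements that read the (2.9) centre, in 8 modules; THIS FILE is the sibling of ONE of them,
re-issuing its Record-13-keyed theorems VERBATIM under the token map σ = (`Θ.liveRepin₁₃ ↦ Θ.liveRepin₁₃Chi … χ`, `gOfRecord₁₃ ↦ gOfRecord₁₃Chi … χ`, `reprTOfRecord₁₃ ↦
reprTOfRecord₁₃Chi … χ`, `EOfRecord₁₃ ↦ EOfRecord₁₃Chi … χ`, `WOfRecord₁₃ ↦ WOfRecord₁₃Chi … χ`, `Provisos₁₃ ↦ Provisos₁₃Chi … χ`, `betaOfRecord₁₃ ↦ betaOfRecord₁₃Chi … χ`,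
`pinRPrime₁₃ ↦ pinRPrime₁₃Chi … χ`, `N0OfRecord₁₃ ↦ N0OfRecord₁₃Chi … χ`; K0a faces `↦ …Chi_…`), same short names in the sibling namespace (dag-n11-d's convention; consumers
switch by namespace).  dag-n11-e's three live-selector wrappers (`ppSel_succ_idem_of_liveSel`, `liveRepin₁₃_liveSel`, `rstep₁₃_of_liveSel_of_hasResiduals`) are NOT
restated: their one-line bodies over the history-generic NODE 00 lemmas (`ppSelLiveOfRecord_succ_idem`, `rfl`, `rstep₁₃_of_localBg_liveSel_chi`) are inlined.  At
`χ := chiβOfRecord₁₃ Θ` every theorem IS the parent's (definitionally, [Ax-3b]'s `rfl` receipts); at `χ := chiβOfRecord₁₃Ax Θ` it is what the re-centred record's N12 road reads.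
Nothing of record edited (body-freeze №460 (2)).

HONEST FRAMING.  Kernel bookkeeping BY NAME, χ-generic (definitions over the β-slot parameter + the parents' proofs verbatim); the displayed rows of the parent stay DISPLAYED;
nothing of Bałaban's asserted; N12 NOT discharged; K0ᴬ ∕ K1ᴬ ∕ K3ᴬ OPEN; counts unmoved; one finite 𝕋⁴ programme at fixed `ε = L^{-K}` — NOT continuum ∕ ℝ⁴ ∕ OS; NOT the
Yang–Mills mass gap (Clay).  THEOREMS ONLY (0 `def`, 0 `instance`, 0 `sorry`).  Filed `--kind proof --supports stmt-QuantumFields-27239 --as helper` (K1ᴬ, route rev 31∕32).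
Sources (bookkeeping only): [Balaban1989LargeFieldI] (0.2)–(0.6) pp.176–177, Prop. 1 (1.78) p.194, (1.80) p.195, (1.89) p.198, (1.99)–(1.102) pp.200–201;
[Balaban1988Convergent] (2.18) p.257, (3.22)–(3.25) pp.269–270; [Balaban1987RG1] (0.17)–(0.20) pp.255–256, (2.9) p.266 (the cut-off's centre).
-/

noncomputable section

open scoped BigOperators ENNReal
open MeasureTheory
open scoped Matrix.Norms.L2Operator

namespace Summit.QuantumFields.YangMills.BalabanUVNodes.N12AtRecord13OfResidualsChi

open Literature.MathematicalPhysics.QuantumFieldTheory.Balaban1983to89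
open Literature.MathematicalPhysics.QuantumFieldTheory.Balaban1983to89.T4Continuum (T4Family)
open Literature.MathematicalPhysics.QuantumFieldTheory.Balaban1983to89.DagBinding
open Literature.MathematicalPhysics.QuantumFieldTheory.Balaban1983to89.Node00
open FlowStep (BetaLowerH BetaUpperH)
open FlowStepRuns (genFlow)
open B15Claim189Assembly (new189 chiPP dom)
open B15 (Prop1Printed Ineq180)
open B15.BasicStep (Claim189)
open B8Eq17ClassAkV1 (plaqsOf)
open B15RPrime1100OfRep (rPrimeDataOfSel)
open B16RLeafRecord13AtLive (liveRepin₁₃_liveSel)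
open B16RLeafRecord13LiveRstep (rstep₁₃_of_liveSel_of_hasResiduals kappa_nonneg_theta13OfThm1C E0_nonneg_theta13OfThm1C B0_nonneg_theta13OfThm1C)
open Summit.QuantumFields.YangMills.BalabanUVNodes.N12AtRecord12LiveSelector (forall_mass_pos_ppSelLive_iff)
open Summit.QuantumFields.YangMills.BalabanUVNodes.N12AtRecord13WitnessFamily
  (nodesAtSomeRecord₁₃_of_fourPin_theta13LiveOfNumerics_of_massLive stabilityBR13e_thetaShape16_fourPin_theta13LiveOfNumerics_of_massLive)
open Summit.QuantumFields.YangMills.BalabanUVNodes.N12AtRecord13LiveLineChi (b15Leaf_WOfRecord₁₃_liveRepin₁₃_of_provisosInt_massSel)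

variable {N : ℕ} [NeZero N] {F : T4Family}

section GenericChi
variable (θ : Stage13Params F N) (χ : ChiSlot F N)

/-- **def-T's STEP PROVISOS `TStepProvisos` AT EVERY STEP `k < K` ALONG THE ₁₃ HISTORIES FROM K0b's RESIDUALS OF RECORD ALONE, ANY SELECTOR** — the fields
`intPiece ∕ measW ∕ absW_le ∕ measChi ∕ unity` by `Node00/Record13` §4c over seat K0c's absolute (H-U) theorem `localBgMeasurable` and K0b's ζ-laws of the (3.16) factor
(`zetaMeasurable_zeta316OfRecord_of_localBg`, `HasResidualsOfRecord.zetaAbs ∕ .zetaUnity`, `zeta316OfRecord_nonneg`); the `hres`-keyed twin of `Provisos₁₃.tstep` — NO proviso field.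
[cite: Balaban1988Convergent, (2.12) p.256, (2.18) p.257, (3.2)–(3.9) pp.265–266, (3.16) p.268, (3.20)–(3.21) p.269, (3.24)–(3.25) p.270; Balaban1989LargeFieldI, (0.3)–(0.4) p.176 (bookkeeping)] -/
theorem tstepProvisos₁₃_of_hasResiduals (hres : θ.HasResidualsOfRecord F N) (P : B12.RunParams) (k : ℕ) (hk : k < P.K) :
    TStepProvisos F N θ.ν θ.τ9 (EOfRecord₁₃Chi F N θ χ) (wOfRecord₉ F N θ.toStage9Params) θ.ppSel P (gOfRecord₁₃Chi F N θ χ P) k :=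
  have hU : LocalBgMeasurable F N θ.ν := localBgMeasurable F N θ.ν
  have hζ : ZetaMeasurable F N θ.ζ := by
    rw [hres.zeta_eq]; exact zetaMeasurable_zeta316OfRecord_of_localBg hU θ.τ9.M θ.A₁
  have hζ0 : ∀ p g k s Pl Ql RS U V', 0 ≤ θ.ζ p g k s Pl Ql RS U V' := by
    rw [hres.zeta_eq]; exact fun p g k s Pl Ql RS U V' => zeta316OfRecord_nonneg θ.A₁ p g k s Pl Ql RS U V'
  { intPiece := θ.intPiece₁₃_of_localBg_chi χ hU hζ hres.zetaAbs hζ0 P k hk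
    measW := fun s' => measurable_wOfRecord F N θ.ν θ.τ9.M θ.A₁ θ.ζ P (gOfRecord₁₃Chi F N θ χ P) k (θ.measω₁₃_of_localBg_chi χ hU hζ P k hk) s'
    absW_le := fun s' U V' => abs_wOfRecord_le_one F N θ.ν θ.τ9.M θ.A₁ hres.zetaAbs P (gOfRecord₁₃Chi F N θ χ P) k s' U V'
    measChi := θ.measChi₁₃_of_localBg_chi χ hU P k hk
    unity := isStepUnity_wOfRecord F N θ.ν θ.τ9.M θ.A₁ hres.zetaUnity P (gOfRecord₁₃Chi F N θ χ P) k }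

end GenericChi

section RepinChi
variable (Θ : Stage13Params F N) (χ : ChiSlot F N) (lam : ResidW F N)

/-- The χ-generic `rstep` row (tower form, integrable currency) AT THE χ LIVE RE-PIN from K0b's residuals of record alone — node00-def-Y's `rstep₁₃_of_localBg_liveSel_chi` at the
re-pin's selector clause `liveRepin₁₃Chi_ppSel` (`rfl`), K0c's absolute (H-U) theorem and the ζ-laws of the (3.16) factor (dag-n11-e's `rstep₁₃_of_liveSel_of_hasResiduals`, inlined in the χ slot).
[cite: Balaban1989LargeFieldI, (0.3)–(0.4) p.176, p.177 (i)–(ii); Balaban1988Convergent, (3.16) p.268, (3.24)–(3.25) p.270 (bookkeeping)] -/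
theorem provisosInt_towerRep_liveRepin₁₃Chi_of_hasResiduals (hres : Θ.HasResidualsOfRecord F N) (P : B12.RunParams) (k : ℕ)
    [DecidableEq (PBond (F.P P.K) (k + 1))] (hk : k < P.K) :
    (towerRepOfRecord F N Θ.ν Θ.τ9 (slotsTOfRecord F N Θ.ν Θ.τ9 (EOfRecord₁₃Chi F N (Θ.liveRepin₁₃Chi F N χ) χ) (wOfRecord₉ F N (Θ.liveRepin₁₃Chi F N χ).toStage9Params)
        (Θ.liveRepin₁₃Chi F N χ).ppSel) (Θ.liveRepin₁₃Chi F N χ).ppSel P (gOfRecord₁₃Chi F N (Θ.liveRepin₁₃Chi F N χ) χ P) (k + 1)).toRepData.ProvisosInt := by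
  have hres' : (Θ.liveRepin₁₃Chi F N χ).HasResidualsOfRecord F N := Stage13Params.HasResidualsOfRecord.liveRepin₁₃Chi hres
  have hζ : ZetaMeasurable F N (Θ.liveRepin₁₃Chi F N χ).ζ := by
    rw [hres'.zeta_eq]; exact zetaMeasurable_zeta316OfRecord_of_localBg (localBgMeasurable F N Θ.ν) Θ.τ9.M Θ.A₁
  have hζ0 : ∀ p g k s Pl Ql RS U V', 0 ≤ (Θ.liveRepin₁₃Chi F N χ).ζ p g k s Pl Ql RS U V' := by
    rw [hres'.zeta_eq]; exact fun p g k s Pl Ql RS U V' => zeta316OfRecord_nonneg Θ.A₁ p g k s Pl Ql RS U V'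
  exact (Θ.liveRepin₁₃Chi F N χ).rstep₁₃_of_localBg_liveSel_chi χ (Stage13Params.liveRepin₁₃Chi_ppSel F N Θ χ) (localBgMeasurable F N Θ.ν) hζ
    hres'.zetaAbs hζ0 P k hk


/-- **def-R's INTEGRABLE-FORM (0.3) PROVISOS OF THE N12 KNIT DATUM AT `Tstep rep_k` OF RECORD, AT THE ₁₃ LIVE RE-PIN, FROM K0b's RESIDUALS ALONE** (`k < K`): dag-n11-e's
`rstep₁₃_of_liveSel_of_hasResiduals` (def-T's row `rstep` is a theorem at the live selector — `Record13` §4c `rstep₁₃_of_localBg_liveSel` over K0c's `localBgMeasurable`) read through def-R's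
`rfl` bridge `toRepData_towerRepOfRecord_eq`; the `hres`-keyed twin of 12A's `provisosInt_reprTOfRecord₁₃_of_provisos₁₃`. [cite: Balaban1989LargeFieldI, (0.3)–(0.4) p.176, p.177 (i)–(ii); Balaban1988Convergent, (3.22) p.269, (3.24)–(3.25) p.270 (bookkeeping)] -/
theorem provisosInt_reprTOfRecord₁₃_liveRepin₁₃_of_hasResiduals (hres : Θ.HasResidualsOfRecord F N) (P : B12.RunParams) (k : ℕ)
    [DecidableEq (PBond (F.P P.K) (k + 1))] (hk : k < P.K) :
    (repDataOfSel (reprTOfRecord₁₃Chi F N (Θ.liveRepin₁₃Chi F N χ) χ P k)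
      ((Θ.liveRepin₁₃Chi F N χ).ppSel P (gOfRecord₁₃Chi F N (Θ.liveRepin₁₃Chi F N χ) χ P) (k + 1))
      (fibOfSeq F (Θ.liveRepin₁₃Chi F N χ).ν (Θ.liveRepin₁₃Chi F N χ).τ9 P (gOfRecord₁₃Chi F N (Θ.liveRepin₁₃Chi F N χ) χ P) (k + 1))).ProvisosInt := by
  have h := provisosInt_towerRep_liveRepin₁₃Chi_of_hasResiduals Θ χ hres P k hk
  rw [toRepData_towerRepOfRecord_eq] at h
  exact h

/-- **BELOW THE TORUS, AT THE ₁₃ LIVE RE-PIN OF A PARAMETER CARRYING K0b's RESIDUALS, N12's MASS DISPLAY ⟺ «every LIVE pre-𝐑 term has positive mass»** — 12B's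
`massSel_liveRepin₁₃_iff` with `Provisos₁₃.tstep ∕ .rstep` at the re-pin replaced by §1's theorems of `hres` (K0a's `exists_liveSeq_ppSelLive_of_int`, this seat's g4
`forall_mass_pos_ppSelLive_iff`). [cite: Balaban1989LargeFieldI, (0.3) p.176, p.176 ll.14–16; Balaban1988Convergent, (3.16) p.268, (3.22)–(3.25) pp.269–270] -/
theorem massSel_liveRepin₁₃_iff_of_hasResiduals (hres : Θ.HasResidualsOfRecord F N) (P : B12.RunParams) {k : ℕ} (hk : k < P.K) :
    (∀ s, 0 < ∫ V, rterm (reprTOfRecord₁₃Chi F N (Θ.liveRepin₁₃Chi F N χ) χ P k)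
        ((Θ.liveRepin₁₃Chi F N χ).ppSel P (gOfRecord₁₃Chi F N (Θ.liveRepin₁₃Chi F N χ) χ P) (k + 1) s) V ∂(fieldMeasure (F.P P.K) (k + 1) (SU N))) ↔
      ∀ s, LiveSeq F N Θ.ν Θ.τ9 P (gOfRecord₁₃Chi F N (Θ.liveRepin₁₃Chi F N χ) χ P) (k + 1)
          (slotsTOfRecord F N Θ.ν Θ.τ9 (EOfRecord₁₃Chi F N (Θ.liveRepin₁₃Chi F N χ) χ) (wOfRecord₉ F N (Θ.liveRepin₁₃Chi F N χ).toStage9Params)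
            (Θ.liveRepin₁₃Chi F N χ).ppSel P (gOfRecord₁₃Chi F N (Θ.liveRepin₁₃Chi F N χ) χ P) (k + 1)) s →
        0 < ∫ V, rterm (reprTOfRecord₁₃Chi F N (Θ.liveRepin₁₃Chi F N χ) χ P k) s V ∂(fieldMeasure (F.P P.K) (k + 1) (SU N)) := by
  have hres' : (Θ.liveRepin₁₃Chi F N χ).HasResidualsOfRecord F N := Stage13Params.HasResidualsOfRecord.liveRepin₁₃Chi hres
  have hex := exists_liveSeq_ppSelLive_of_int F N Θ.ν Θ.τ9 (EOfRecord₁₃Chi F N Θ χ) (wOfRecord₉ F N Θ.toStage9Params) P (gOfRecord₁₃Chi F N Θ χ P)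
    (fun j hj => tstepProvisos₁₃_of_hasResiduals (Θ.liveRepin₁₃Chi F N χ) χ hres' P j hj)
    (fun j _ hj => provisosInt_towerRep_liveRepin₁₃Chi_of_hasResiduals Θ χ hres P j hj) k hk
  exact forall_mass_pos_ppSelLive_iff (EOfRecord₁₃Chi F N Θ χ) (wOfRecord₉ F N Θ.toStage9Params) P (gOfRecord₁₃Chi F N Θ χ P) k hex _ _

/-- **★★ N12's ROW AT THE ₁₃ LIVE RE-PIN's BUNDLE OF RECORD FROM K0b's RESIDUALS ALONE** (`kSel P < K`): `Θ.HasResidualsOfRecord` + the (1.100) pin equation + «every LIVE pre-𝐑 term at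
level `kSel P + 1` has positive mass» + EXACTLY Proposition 1 (1.78), (1.80), (1.89) ⇒ `B15Leaf (WOfRecord₁₃ (Θ.liveRepin₁₃) λ P)` — NO `Provisos₁₃`, NO row P11, NO admissibility, NO `hfib`
(12B's `b15Leaf_WOfRecord₁₃_liveRepin₁₃_of_provisosInt_massSel` fed by `provisosInt_reprTOfRecord₁₃_liveRepin₁₃_of_hasResiduals` and `massSel_liveRepin₁₃_iff_of_hasResiduals`).
[cite: Balaban1989LargeFieldI, (0.2)–(0.6) p.176, p.176 ll.14–16, p.177 (i)–(ii), Prop. 1 (1.78) p.194, (1.80) p.195, (1.89) p.198, (1.99)–(1.102) pp.200–201; Balaban1988Convergent, (3.16) p.268, (3.22)–(3.25) pp.269–270] -/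
theorem b15Leaf_WOfRecord₁₃_liveRepin₁₃_of_massLive_of_hasResiduals (hres : Θ.HasResidualsOfRecord F N) {P : B12.RunParams} (hk : lam.kSel P < P.K)
    (hpin : lam.D1100 P
      = rPrimeDataOfSel (reprTOfRecord₁₃Chi F N (Θ.liveRepin₁₃Chi F N χ) χ P (lam.kSel P))
          ((Θ.liveRepin₁₃Chi F N χ).ppSel P (gOfRecord₁₃Chi F N (Θ.liveRepin₁₃Chi F N χ) χ P) (lam.kSel P + 1))
          (fibOfSeq F (Θ.liveRepin₁₃Chi F N χ).ν (Θ.liveRepin₁₃Chi F N χ).τ9 P (gOfRecord₁₃Chi F N (Θ.liveRepin₁₃Chi F N χ) χ P) (lam.kSel P + 1)))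
    (hmassLive : ∀ s, LiveSeq F N Θ.ν Θ.τ9 P (gOfRecord₁₃Chi F N (Θ.liveRepin₁₃Chi F N χ) χ P) (lam.kSel P + 1)
        (slotsTOfRecord F N Θ.ν Θ.τ9 (EOfRecord₁₃Chi F N (Θ.liveRepin₁₃Chi F N χ) χ) (wOfRecord₉ F N (Θ.liveRepin₁₃Chi F N χ).toStage9Params)
          (Θ.liveRepin₁₃Chi F N χ).ppSel P (gOfRecord₁₃Chi F N (Θ.liveRepin₁₃Chi F N χ) χ P) (lam.kSel P + 1)) s →
      0 < ∫ V, rterm (reprTOfRecord₁₃Chi F N (Θ.liveRepin₁₃Chi F N χ) χ P (lam.kSel P)) s V ∂(fieldMeasure (F.P P.K) (lam.kSel P + 1) (SU N)))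
    (hP1 : Prop1Printed (lam.LF P))
    (h180 : ∀ U, new189 (lam.D189 P) U → ∀ i, (lam.D189 P).h ≤ i → i ≤ (lam.D189 P).k → ∀ q ∈ plaqsOf (dom (lam.D189 P) i),
      Ineq180 ((lam.D189 P).dev0 U q) ((lam.D189 P).ε (lam.D189 P).k) (lam.D189 P).η (lam.D189 P).B₃ (lam.D189 P).B₅ (lam.D189 P).M (lam.D189 P).δ
        ((lam.D189 P).dist q) (lam.D189 P).O1)
    (h189 : Claim189 (new189 (lam.D189 P)) (chiPP (lam.D189 P))) : B15Leaf (WOfRecord₁₃Chi F N (Θ.liveRepin₁₃Chi F N χ) χ lam P) := by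
  classical
  exact b15Leaf_WOfRecord₁₃_liveRepin₁₃_of_provisosInt_massSel Θ χ lam
    (provisosInt_reprTOfRecord₁₃_liveRepin₁₃_of_hasResiduals Θ χ hres P (lam.kSel P) hk) hpin
    ((massSel_liveRepin₁₃_iff_of_hasResiduals Θ χ hres P hk).2 hmassLive) hP1 h180 h189

/-- **N12's ROW FOR A WHOLE TOWER OF RUNS AT THE LIVE RE-PIN FROM K0b's RESIDUALS ALONE, run by run**: below the torus (`kSel P < K`) the live-mass form, on the other runs (`K ≤ kSel P`,
where the record displays no tower clause) the leaf handed as is — the `hres`-keyed twin of 12B's `…_all_of_massLive`; feeds the `h12` slot of 12B §4 ∕ dag-n24-c's modules 40–41 verbatim.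
[cite: Balaban1989LargeFieldI, (0.2)–(0.6) p.176, Prop. 1 (1.78) p.194, (1.80) p.195, (1.89) p.198, (1.99)–(1.102) pp.200–201 (bookkeeping)] -/
theorem b15Leaf_WOfRecord₁₃_liveRepin₁₃_all_of_massLive_of_hasResiduals (hres : Θ.HasResidualsOfRecord F N)
    (hdeg : ∀ P : B12.RunParams, P.K ≤ lam.kSel P → B15Leaf (WOfRecord₁₃Chi F N (Θ.liveRepin₁₃Chi F N χ) χ lam P))
    (hpin : ∀ P : B12.RunParams, lam.kSel P < P.K → lam.D1100 P
      = rPrimeDataOfSel (reprTOfRecord₁₃Chi F N (Θ.liveRepin₁₃Chi F N χ) χ P (lam.kSel P))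
          ((Θ.liveRepin₁₃Chi F N χ).ppSel P (gOfRecord₁₃Chi F N (Θ.liveRepin₁₃Chi F N χ) χ P) (lam.kSel P + 1))
          (fibOfSeq F (Θ.liveRepin₁₃Chi F N χ).ν (Θ.liveRepin₁₃Chi F N χ).τ9 P (gOfRecord₁₃Chi F N (Θ.liveRepin₁₃Chi F N χ) χ P) (lam.kSel P + 1)))
    (hmassLive : ∀ P : B12.RunParams, lam.kSel P < P.K → ∀ s, LiveSeq F N Θ.ν Θ.τ9 P (gOfRecord₁₃Chi F N (Θ.liveRepin₁₃Chi F N χ) χ P) (lam.kSel P + 1)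
        (slotsTOfRecord F N Θ.ν Θ.τ9 (EOfRecord₁₃Chi F N (Θ.liveRepin₁₃Chi F N χ) χ) (wOfRecord₉ F N (Θ.liveRepin₁₃Chi F N χ).toStage9Params)
          (Θ.liveRepin₁₃Chi F N χ).ppSel P (gOfRecord₁₃Chi F N (Θ.liveRepin₁₃Chi F N χ) χ P) (lam.kSel P + 1)) s →
      0 < ∫ V, rterm (reprTOfRecord₁₃Chi F N (Θ.liveRepin₁₃Chi F N χ) χ P (lam.kSel P)) s V ∂(fieldMeasure (F.P P.K) (lam.kSel P + 1) (SU N)))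
    (hP1 : ∀ P : B12.RunParams, lam.kSel P < P.K → Prop1Printed (lam.LF P))
    (h180 : ∀ P : B12.RunParams, lam.kSel P < P.K → ∀ U, new189 (lam.D189 P) U → ∀ i, (lam.D189 P).h ≤ i → i ≤ (lam.D189 P).k →
      ∀ q ∈ plaqsOf (dom (lam.D189 P) i),
        Ineq180 ((lam.D189 P).dev0 U q) ((lam.D189 P).ε (lam.D189 P).k) (lam.D189 P).η (lam.D189 P).B₃ (lam.D189 P).B₅ (lam.D189 P).M (lam.D189 P).δ
          ((lam.D189 P).dist q) (lam.D189 P).O1)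
    (h189 : ∀ P : B12.RunParams, lam.kSel P < P.K → Claim189 (new189 (lam.D189 P)) (chiPP (lam.D189 P))) :
    ∀ P : B12.RunParams, B15Leaf (WOfRecord₁₃Chi F N (Θ.liveRepin₁₃Chi F N χ) χ lam P) := fun P => by
  by_cases hk : lam.kSel P < P.K
  · exact b15Leaf_WOfRecord₁₃_liveRepin₁₃_of_massLive_of_hasResiduals Θ χ lam hres hk (hpin P hk) (hmassLive P hk) (hP1 P hk) (h180 P hk) (h189 P hk)
  · exact hdeg P (not_lt.1 hk)

end RepinChi

end Summit.QuantumFields.YangMills.BalabanUVNodes.N12AtRecord13OfResidualsChi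

end
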